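import Literature.Analysis.FluidPDE.AxisymmetricTypeIPressureBounds
import Literature.Analysis.FluidPDE.SereginEpsilonRegularity
import Literature.Analysis.FluidPDE.SereginSverakBlowupSelection
import Literature.Analysis.FluidPDE.AxisymmetricVorticityTransport
import Literature.Analysis.FluidPDE.TsaiLocalEnergyProofs
import HarnessLib

/-!
# Boundedness near the final time off the axis: `axisymmetric_typeI_boundedNearTop_offAxis`
# from Seregin's multi-scale dissipation ε-regularity criterion (Seregin 2014, Ch. 6, Thm. 1.4)

Analysis/FluidPDE proofs-layer file (theorems only), third layer of the decomposition of
`Literature.Analysis.FluidPDE.knss_no_axisymmetric_typeI` (`Axisymmetric.lean`) through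
`axisymmetric_typeI_bounded` (`KNSSTypeII.lean`) and its local inputs
(`AxisymmetricTypeIBounded.lean`). It PROVES the off-axis input

  `axisymmetric_typeI_boundedNearTop_offAxis_of_seregin :
     seregin2014_thm14 → axisymmetric_typeI_boundedNearTop_offAxis`

from the accepted backward ε-regularity criterion in the multi-scale dissipation form
(`seregin2014_thm14`, `SereginEpsilonRegularity.lean`; Seregin 2014, Ch. 6, §6.1, Thm. 1.4: a
suitable weak solution in `Q = Q(0, 1)` with `sup_{0<r<1} E(r) < ε`, `E(r) = r⁻¹ ∫∫_{Q(r)} |∇v|²`,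
is essentially bounded near the vertex), as announced in `AxisymmetricTypeIBounded.lean` — the
classical observation that for axisymmetric flows of finite dissipation every point OFF the axis
is regular (Seregin–Šverák 2009, §3, before Lemma 3.3, arXiv p. 9: "It is well-known due to
Caffarelli-Kohn-Nirenberg that if `z = (x, t)` is singular (i.e., not regular) point of `v`, then
there must be `x' = 0`. In other words, all singular points must belong to the axis of
symmetry"), here realised by the rotation-packing of the dissipation.

## The argument

Let `H : AxisymmetricTypeIHyp ν T u p` (the Type I rate is not used), `x₀` with
`ρ₀ = |x₀'| = cylRadius x₀ > 0`, `q` the gauged pressure (`exists_gauged_pressure`).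

* *Rotation invariance of the dissipation.* `u(t)` is axisymmetric for `0 ≤ t < T`, so
  `|∇u(t, R_θ x)|² = |∇u(t, x)|²` (`IsAxisymmetric.frobeniusNormSq_fderiv_rotZ`: conjugation of
  `∇u` by the rotation, `fderiv_conj_linearIsometryEquiv`, and invariance of the Frobenius norm,
  `frobeniusNormSq_conj_linearIsometryEquiv`); hence
  `∫_{I × B(R_θ x₀, ρ)} |∇u|² = ∫_{I × B(x₀, ρ)} |∇u|²` (the space–time rotation preserves Lebesgue
  measure; `setLIntegral_prod_ball_rotZ_eq`).
* *Packing.* For `0 < ρ ≤ ρ₀` the `N = ⌈ρ₀/ρ⌉` balls `B(R_{kδ} x₀, ρ)`, `δ = πρ/ρ₀`, `k < N`, are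
  pairwise disjoint (chord `|R_a x₀ − R_b x₀|² = 2(1 − cos(a − b)) ρ₀²`, `dist_rotZ_rotZ_sq`, with
  `δ ≤ |a − b| ≤ (N − 1)δ ≤ π` and `1 − cos δ ≥ 2δ²/π²`), so
  `∫_{I × B(x₀, ρ)} |∇u|² ≤ (ρ/ρ₀) ∫_{I × ℝ³} |∇u|²` (`setLIntegral_prod_ball_le_of_axisymmetric`).
* *Vanishing dissipation tails.* `∫∫_{(0,T) × ℝ³} |∇u|² < ∞` (the classical gradient is a weak
  spatial gradient on the slab, `hasWeakSpatialGradientOn_of_contDiffOn`, hence agrees a.e. with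
  the square-integrable Leray–Hopf gradient, `IsLerayHopfOn.exists_hasWeakSpatialGradientOn`,
  `HasWeakSpatialGradientOn.ae_eq`), so `D(τ) = ∫∫_{(T−τ,T) × ℝ³} |∇u|² → 0` as `τ → 0`
  (continuity from above of the measure with density `|∇u|²`; `exists_time_tail_lt`).
* *Rescaling.* With `R > 0` small (`R ≤ ρ₀`, `R²/ν ≤ τ₀` where `D(τ₀) < ε ν ρ₀`, and the
  `ν`-cylinders about `(T, x₀)` inside the slab), `α = R/ν`, `β = R²/ν`,
  `Φ(s, y) = (T + βs, x₀ + Ry)`, the pair `v = α u ∘ Φ`, `π = α² q ∘ Φ` is a suitable weak solution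
  of the unit-viscosity system in `Q(0, 1)` (`IsSuitableWeakSolutionOn.stRescale`,
  `stAffine_preimage_cylinder_eq_parabolicCylinder`) in the global class of
  `IsSuitableWeakSolutionInBall 1 0` (energy inequality, `eEnergy_le`; the rescaled classical
  gradient `(αR) ∇u ∘ Φ`, `HasWeakSpatialGradientOn.stRescale`; `π ∈ L^{3/2}`,
  `lintegral_cylinder_gauged_pressure_lt_top`), and by the change of variables
  `setLIntegral_frobeniusNormSq_stRescale` and the packing bound,
  `E(r) = (νRr)⁻¹ ∫∫_{(T−βr², T) × B(x₀, Rr)} |∇u|² ≤ D(β)/(ν ρ₀) < ε` for all `0 < r < 1`.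
* *Conclusion.* The criterion bounds `v` essentially on some `Q(0, ϱ)`; transporting back along
  `Φ` and using the continuity of `u` below `T` gives a bound of `u` on
  `(T − r'², T) × B(x₀, r')` (`isBoundedNearTop_of_eLpNorm_rescaled_lt_top`), i.e.
  `IsBoundedNearTop u T x₀`.

## References

* G. Seregin, *Lecture Notes on Regularity Theory for the Navier–Stokes Equations*, World
  Scientific 2014, Ch. 6, §6.1, Thm. 1.4. [Seregin2014]
* L. Caffarelli, R. Kohn, L. Nirenberg, Comm. Pure Appl. Math. 35 (1982). [CaffarelliKohnNirenberg1982]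
* G. Seregin, V. Šverák, *On Type I singularities of the local axi-symmetric solutions of the
  Navier–Stokes equations*, Comm. PDE 34 (2009), §3 (arXiv:0804.1803, p. 9). [SereginSverak2009]
* G. Koch, N. Nadirashvili, G. Seregin, V. Šverák, Acta Math. 203 (2009), §6. [KNSS2009]
-/

noncomputable section

open MeasureTheory Set Function Filter Topology TopologicalSpace Metric Module
open scoped NNReal ENNReal InnerProductSpace RealInnerProductSpace

namespace Literature.Analysis.FluidPDE

/-- Local notation for physical space `ℝ³ = EuclideanSpace ℝ (Fin 3)`. -/
local notation "ℝ³" => EuclideanSpace ℝ (Fin 3)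

/-! ### Rotation invariance of the dissipation density -/

/-- The Frobenius norm is invariant under conjugation by a linear isometry:
`|R ∘ A ∘ R⁻¹|² = |A|²` (sum over the orthonormal basis `R b`). [folklore] -/
theorem frobeniusNormSq_conj_linearIsometryEquiv {E : Type*} [NormedAddCommGroup E]
    [InnerProductSpace ℝ E] [FiniteDimensional ℝ E] (R : E ≃ₗᵢ[ℝ] E) (A : E →L[ℝ] E) :
    frobeniusNormSq ((R : E →L[ℝ] E).comp (A.comp (R.symm : E →L[ℝ] E))) = frobeniusNormSq A := by
  rw [frobeniusNormSq_eq_sum ((stdOrthonormalBasis ℝ E).map R),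
    frobeniusNormSq_eq_sum (stdOrthonormalBasis ℝ E)]
  refine Finset.sum_congr rfl fun i _ => ?_
  simp [OrthonormalBasis.map_apply]

/-- **Rotation invariance of `|∇v|²` for axisymmetric fields**: `|∇v(R_θ x)|² = |∇v(x)|²`
(`v = R_θ ∘ v ∘ R_{-θ}`, so `∇v(y) = R_θ ∇v(R_{-θ} y) R_{-θ}`; KNSS 2009, §1, (1.5)). [folklore] -/
theorem IsAxisymmetric.frobeniusNormSq_fderiv_rotZ {v : ℝ³ → ℝ³} (hv : IsAxisymmetric v) (θ : ℝ)
    (x : ℝ³) : frobeniusNormSq (fderiv ℝ v (rotZ θ x)) = frobeniusNormSq (fderiv ℝ v x) := by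
  set R := rotZLIE θ with hR
  have hconj : (fun y => R (v (R.symm y))) = v := by
    funext y
    exact hv.rotZ_apply_rotZ_neg θ y
  have h1 := fderiv_conj_linearIsometryEquiv R v (rotZ θ x)
  rw [hconj] at h1
  rw [h1, frobeniusNormSq_conj_linearIsometryEquiv]
  congr 2
  show rotZ (-θ) (rotZ θ x) = x
  rw [← rotZ_add, neg_add_cancel, rotZ_zero]

/-- **Rotated cylinders carry the same dissipation**: if `u(t)` is axisymmetric for `t ∈ I`, then
`∫_{I × B(R_θ x₀, ρ)} |∇u|² = ∫_{I × B(x₀, ρ)} |∇u|²` (the space–time rotation `(t, x) ↦ (t, R_θ x)`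
preserves Lebesgue measure and pulls `I × B(R_θ x₀, ρ)` back to `I × B(x₀, ρ)`). [folklore] -/
theorem setLIntegral_prod_ball_rotZ_eq {u : ℝ → ℝ³ → ℝ³} {I : Set ℝ} (hI : MeasurableSet I)
    (hax : ∀ t ∈ I, IsAxisymmetric (u t)) (θ : ℝ) (x₀ : ℝ³) (ρ : ℝ) :
    ∫⁻ z in I ×ˢ ball (rotZ θ x₀) ρ, ENNReal.ofReal (frobeniusNormSq (fderiv ℝ (u z.1) z.2)) =
      ∫⁻ z in I ×ˢ ball x₀ ρ, ENNReal.ofReal (frobeniusNormSq (fderiv ℝ (u z.1) z.2)) := by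
  set Ψ : ℝ × ℝ³ → ℝ × ℝ³ := Prod.map id (rotZLIE θ) with hΨdef
  have hΨ : ∀ z, Ψ z = (z.1, rotZ θ z.2) := fun z => rfl
  have hmp : MeasurePreserving Ψ (volume : Measure (ℝ × ℝ³)) volume :=
    (MeasurePreserving.id (volume : Measure ℝ)).prod (rotZLIE θ).measurePreserving
  have hemb : MeasurableEmbedding Ψ :=
    MeasurableEmbedding.id.prodMap (rotZLIE θ).toHomeomorph.measurableEmbedding
  have hpre : Ψ ⁻¹' (I ×ˢ ball (rotZ θ x₀) ρ) = I ×ˢ ball x₀ ρ := by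
    ext ⟨t, x⟩
    simp only [mem_preimage, hΨ, mem_prod, mem_ball]
    rw [← rotZLIE_apply θ x, ← rotZLIE_apply θ x₀, (rotZLIE θ).dist_map]
  rw [← hmp.setLIntegral_comp_preimage_emb hemb _ (I ×ˢ ball (rotZ θ x₀) ρ), hpre]
  refine setLIntegral_congr_fun (hI.prod measurableSet_ball) fun z hz => ?_
  simp only [hΨ]
  rw [(hax z.1 hz.1).frobeniusNormSq_fderiv_rotZ θ z.2]

/-! ### The packing of rotated balls -/

/-- **Chords of the circle of rotated points**: `|R_a x − R_b x|² = 2 (1 − cos(a − b)) |x'|²`. [folklore] -/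
theorem dist_rotZ_rotZ_sq (a b : ℝ) (x : ℝ³) :
    dist (rotZ a x) (rotZ b x) ^ 2 = 2 * (1 - Real.cos (a - b)) * cylRadius x ^ 2 := by
  rw [dist_eq_norm, EuclideanSpace.norm_sq_eq, Fin.sum_univ_three, cylRadius_sq, Real.cos_sub]
  simp only [PiLp.sub_apply, rotZ_apply_zero, rotZ_apply_one, rotZ_apply_two, Real.norm_eq_abs,
    sq_abs, sub_self]
  linear_combination (x 0 ^ 2 + x 1 ^ 2) * Real.sin_sq_add_cos_sq a +
    (x 0 ^ 2 + x 1 ^ 2) * Real.sin_sq_add_cos_sq b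

/-- Jordan's inequality in the form `2 δ² ≤ π² (1 − cos δ)` for `0 ≤ δ ≤ π`
(`1 − cos δ = 2 sin²(δ/2)` and `sin(δ/2) ≥ δ/π`). [folklore] -/
theorem two_mul_sq_le_pi_sq_mul_one_sub_cos {δ : ℝ} (h0 : 0 ≤ δ) (hπ : δ ≤ Real.pi) :
    2 * δ ^ 2 ≤ Real.pi ^ 2 * (1 - Real.cos δ) := by
  have h1 : 1 - Real.cos δ = 2 * Real.sin (δ / 2) ^ 2 := by
    rw [Real.sin_sq_eq_half_sub, mul_div_cancel₀ δ two_ne_zero]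
    ring
  have hj : 2 / Real.pi * (δ / 2) ≤ Real.sin (δ / 2) :=
    Real.mul_le_sin (by positivity) (by linarith)
  have hj' : δ / Real.pi ≤ Real.sin (δ / 2) := by
    have e : 2 / Real.pi * (δ / 2) = δ / Real.pi := by ring
    rwa [e] at hj
  have hj0 : 0 ≤ δ / Real.pi := by positivity
  have h3 : (δ / Real.pi) ^ 2 ≤ Real.sin (δ / 2) ^ 2 := pow_le_pow_left₀ hj0 hj' 2
  have h4 : Real.pi ^ 2 * (δ / Real.pi) ^ 2 = δ ^ 2 := by
    field_simp
  have h5 := mul_le_mul_of_nonneg_left h3 (sq_nonneg Real.pi)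
  rw [h4] at h5
  rw [h1]
  linarith

/-- **Separation of the rotated centres**: for centres `R_{jδ} x₀`, `j < k < N`, with
`(N − 1) δ ≤ π`, `δ ≥ 0` and `4ρ² ≤ 2(1 − cos δ)|x₀'|²`, one has `|R_{jδ} x₀ − R_{kδ} x₀| ≥ 2ρ`
(the cosine is decreasing on `[0, π]`). [folklore] -/
theorem two_mul_le_dist_rotZ_of_lt {x₀ : ℝ³} {δ ρ : ℝ} {N : ℕ} (hδ : 0 ≤ δ)
    (hN : ((N : ℝ) - 1) * δ ≤ Real.pi) (hρ : 0 ≤ ρ)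
    (hchord : 4 * ρ ^ 2 ≤ 2 * (1 - Real.cos δ) * cylRadius x₀ ^ 2) {j k : ℕ} (hjk : j < k)
    (hk : k < N) :
    2 * ρ ≤ dist (rotZ ((j : ℝ) * δ) x₀) (rotZ ((k : ℝ) * δ) x₀) := by
  have h1 : (j : ℝ) + 1 ≤ k := by exact_mod_cast hjk
  have h2 : (k : ℝ) + 1 ≤ N := by exact_mod_cast hk
  have hj0 : (0 : ℝ) ≤ j := Nat.cast_nonneg j
  -- the angle between the two centres
  have hθδ : δ ≤ ((k : ℝ) - j) * δ := by nlinarith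
  have hθπ : ((k : ℝ) - j) * δ ≤ Real.pi := by
    have : ((k : ℝ) - j) * δ ≤ ((N : ℝ) - 1) * δ := by
      apply mul_le_mul_of_nonneg_right _ hδ
      linarith
    exact this.trans hN
  have hcos : Real.cos (((k : ℝ) - j) * δ) ≤ Real.cos δ :=
    Real.cos_le_cos_of_nonneg_of_le_pi hδ hθπ hθδ
  have hsq : (2 * ρ) ^ 2 ≤ dist (rotZ ((j : ℝ) * δ) x₀) (rotZ ((k : ℝ) * δ) x₀) ^ 2 := by
    rw [dist_rotZ_rotZ_sq, show (j : ℝ) * δ - k * δ = -(((k : ℝ) - j) * δ) by ring, Real.cos_neg]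
    have hr0 := sq_nonneg (cylRadius x₀)
    nlinarith
  exact (pow_le_pow_iff_left₀ (by positivity) dist_nonneg two_ne_zero).1 hsq

/-- **Disjoint cylinders**: for `2ρ`-separated centres `c_k`, `k < N`,
`∑_k ∫_{I × B(c_k, ρ)} F ≤ ∫_{I × ℝ³} F`. [folklore] -/
theorem sum_setLIntegral_prod_ball_le {N : ℕ} (c : Fin N → ℝ³) {ρ : ℝ}
    (hsep : ∀ j k : Fin N, j ≠ k → 2 * ρ ≤ dist (c j) (c k)) {I : Set ℝ} (hI : MeasurableSet I)
    (F : ℝ × ℝ³ → ℝ≥0∞) :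
    ∑ k, ∫⁻ z in I ×ˢ ball (c k) ρ, F z ≤ ∫⁻ z in I ×ˢ (univ : Set ℝ³), F z := by
  have hd : Set.PairwiseDisjoint (↑(Finset.univ : Finset (Fin N))) (fun k => I ×ˢ ball (c k) ρ) := by
    intro j _ k _ hjk
    simp only [Function.onFun]
    rw [Set.disjoint_prod]
    exact Or.inr (ball_disjoint_ball (by linarith [hsep j k hjk]))
  rw [← lintegral_biUnion_finset hd (fun k _ => hI.prod measurableSet_ball)]
  exact lintegral_mono_set (iUnion₂_subset fun k _ => prod_mono_right (subset_univ _))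

namespace AxisymmetricTypeIHyp

variable {ν T : ℝ} {u : ℝ → ℝ³ → ℝ³} {p : ℝ → ℝ³ → ℝ}

/-- **The packing bound**: for `x₀` off the axis, `0 < ρ ≤ ρ₀ = |x₀'|` and `τ ≤ T`,
`∫_{(T−τ,T) × B(x₀, ρ)} |∇u|² ≤ (ρ/ρ₀) ∫_{(T−τ,T) × ℝ³} |∇u|²` (the `N = ⌈ρ₀/ρ⌉ ≥ ρ₀/ρ` rotated
copies of the cylinder are disjoint and carry the same dissipation). [folklore] -/
theorem setLIntegral_prod_ball_le_of_axisymmetric (H : AxisymmetricTypeIHyp ν T u p) {x₀ : ℝ³}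
    (hx₀ : 0 < cylRadius x₀) {ρ τ : ℝ} (hρ : 0 < ρ) (hρle : ρ ≤ cylRadius x₀) (hτ : τ ≤ T) :
    ∫⁻ z in Ioo (T - τ) T ×ˢ ball x₀ ρ, ENNReal.ofReal (frobeniusNormSq (fderiv ℝ (u z.1) z.2)) ≤
      ENNReal.ofReal (ρ / cylRadius x₀) *
        ∫⁻ z in Ioo (T - τ) T ×ˢ (univ : Set ℝ³),
          ENNReal.ofReal (frobeniusNormSq (fderiv ℝ (u z.1) z.2)) := by
  have hIax : ∀ t ∈ Ioo (T - τ) T, IsAxisymmetric (u t) := fun t ht =>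
    H.axisymmetric t ⟨by linarith [ht.1], ht.2⟩
  -- the number of balls
  set N : ℕ := ⌈cylRadius x₀ / ρ⌉₊ with hN
  have hq : 1 ≤ cylRadius x₀ / ρ := by rw [le_div_iff₀ hρ, one_mul]; exact hρle
  have hN1 : cylRadius x₀ / ρ ≤ N := Nat.le_ceil _
  have hN2 : (N : ℝ) < cylRadius x₀ / ρ + 1 := Nat.ceil_lt_add_one (by positivity)
  have hNpos : (0 : ℝ) < N := lt_of_lt_of_le (by linarith) hN1
  have hN0 : N ≠ 0 := by exact_mod_cast hNpos.ne'
  -- the angle step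
  set δ : ℝ := Real.pi * ρ / cylRadius x₀ with hδ
  have hδ0 : 0 ≤ δ := by positivity
  have hδρ : δ * cylRadius x₀ = Real.pi * ρ := by rw [hδ]; field_simp
  have hδπ : δ ≤ Real.pi := by
    rw [hδ, div_le_iff₀ hx₀]
    nlinarith [Real.pi_pos]
  have hNδ : ((N : ℝ) - 1) * δ ≤ Real.pi := by
    have h1 : (N : ℝ) - 1 ≤ cylRadius x₀ / ρ := by linarith
    calc ((N : ℝ) - 1) * δ ≤ cylRadius x₀ / ρ * δ := mul_le_mul_of_nonneg_right h1 hδ0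
      _ = Real.pi := by rw [hδ]; field_simp
  have hchord : 4 * ρ ^ 2 ≤ 2 * (1 - Real.cos δ) * cylRadius x₀ ^ 2 := by
    have h1 := two_mul_sq_le_pi_sq_mul_one_sub_cos hδ0 hδπ
    have h3 : Real.pi ^ 2 * (2 * ρ ^ 2) ≤ Real.pi ^ 2 * ((1 - Real.cos δ) * cylRadius x₀ ^ 2) := by
      have e : Real.pi ^ 2 * (2 * ρ ^ 2) = 2 * δ ^ 2 * cylRadius x₀ ^ 2 := by
        rw [show 2 * δ ^ 2 * cylRadius x₀ ^ 2 = 2 * (δ * cylRadius x₀) ^ 2 by ring, hδρ]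
        ring
      rw [e]
      nlinarith [mul_le_mul_of_nonneg_right h1 (sq_nonneg (cylRadius x₀))]
    have h4 := le_of_mul_le_mul_left h3 (by positivity)
    linarith
  -- the centres
  set c : Fin N → ℝ³ := fun k => rotZ (((k : ℕ) : ℝ) * δ) x₀ with hc
  have hsep : ∀ j k : Fin N, j ≠ k → 2 * ρ ≤ dist (c j) (c k) := by
    intro j k hjk
    rcases lt_or_gt_of_ne (Fin.val_injective.ne hjk) with h | h
    · exact two_mul_le_dist_rotZ_of_lt hδ0 hNδ hρ.le hchord h k.isLt
    · rw [dist_comm]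
      exact two_mul_le_dist_rotZ_of_lt hδ0 hNδ hρ.le hchord h j.isLt
  -- the disjoint rotated cylinders carry `N` times the dissipation of one of them
  have hsum := sum_setLIntegral_prod_ball_le c hsep measurableSet_Ioo
    (fun z : ℝ × ℝ³ => ENNReal.ofReal (frobeniusNormSq (fderiv ℝ (u z.1) z.2))) (I := Ioo (T - τ) T)
  have hterm : ∀ k : Fin N,
      ∫⁻ z in Ioo (T - τ) T ×ˢ ball (c k) ρ, ENNReal.ofReal (frobeniusNormSq (fderiv ℝ (u z.1) z.2)) =
        ∫⁻ z in Ioo (T - τ) T ×ˢ ball x₀ ρ, ENNReal.ofReal (frobeniusNormSq (fderiv ℝ (u z.1) z.2)) :=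
    fun k => setLIntegral_prod_ball_rotZ_eq measurableSet_Ioo hIax _ x₀ ρ
  simp only [hterm, Finset.sum_const, Finset.card_univ, Fintype.card_fin, nsmul_eq_mul] at hsum
  -- division by `N ≥ ρ₀ / ρ`
  have hNtop : (N : ℝ≥0∞) ≠ ∞ := ENNReal.natCast_ne_top N
  have hN0' : (N : ℝ≥0∞) ≠ 0 := by exact_mod_cast hN0
  have hinv : (N : ℝ≥0∞)⁻¹ ≤ ENNReal.ofReal (ρ / cylRadius x₀) := by
    rw [← ENNReal.ofReal_natCast, ← ENNReal.ofReal_inv_of_pos hNpos]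
    refine ENNReal.ofReal_le_ofReal ?_
    rw [inv_le_comm₀ hNpos (by positivity), inv_div]
    exact hN1
  calc ∫⁻ z in Ioo (T - τ) T ×ˢ ball x₀ ρ, ENNReal.ofReal (frobeniusNormSq (fderiv ℝ (u z.1) z.2))
      = (N : ℝ≥0∞)⁻¹ * ((N : ℝ≥0∞) *
          ∫⁻ z in Ioo (T - τ) T ×ˢ ball x₀ ρ, ENNReal.ofReal (frobeniusNormSq (fderiv ℝ (u z.1) z.2))) := by
        rw [← mul_assoc, ENNReal.inv_mul_cancel hN0' hNtop, one_mul]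
    _ ≤ (N : ℝ≥0∞)⁻¹ * ∫⁻ z in Ioo (T - τ) T ×ˢ (univ : Set ℝ³),
          ENNReal.ofReal (frobeniusNormSq (fderiv ℝ (u z.1) z.2)) := by gcongr
    _ ≤ ENNReal.ofReal (ρ / cylRadius x₀) * ∫⁻ z in Ioo (T - τ) T ×ˢ (univ : Set ℝ³),
          ENNReal.ofReal (frobeniusNormSq (fderiv ℝ (u z.1) z.2)) := by gcongr

/-! ### Vanishing dissipation tails -/

/-- **Finite dissipation of the classical gradient on the slab**: `∫∫_{(0,T) × ℝ³} |∇u|² < ∞`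
(the classical gradient is a weak spatial gradient on the slab and so agrees a.e. with the
square-integrable Leray–Hopf gradient). [folklore] -/
theorem lintegral_slab_frobeniusNormSq_fderiv_lt_top (H : AxisymmetricTypeIHyp ν T u p) :
    ∫⁻ z in Ioo 0 T ×ˢ (univ : Set ℝ³), ENNReal.ofReal (frobeniusNormSq (fderiv ℝ (u z.1) z.2)) < ∞ := by
  obtain ⟨G', hG'slab, -, hG'int, -⟩ := H.lerayHopf.exists_hasWeakSpatialGradientOn
  have hGu : HasWeakSpatialGradientOn (slab ℝ³ (Ioo 0 T) isOpen_Ioo) u fun t x => fderiv ℝ (u t) x :=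
    hasWeakSpatialGradientOn_of_contDiffOn isOpen_Ioo (by rw [coe_slab])
      (H.classical_Ioo.smooth_velocity.of_le (by norm_cast))
  have hae := hGu.ae_eq hG'slab
  rw [coe_slab] at hae
  calc ∫⁻ z in Ioo 0 T ×ˢ (univ : Set ℝ³), ENNReal.ofReal (frobeniusNormSq (fderiv ℝ (u z.1) z.2))
      = ∫⁻ z in Ioo 0 T ×ˢ (univ : Set ℝ³), ENNReal.ofReal (frobeniusNormSq (G' z.1 z.2)) := by
        refine lintegral_congr_ae ?_
        filter_upwards [hae] with z hz
        change ENNReal.ofReal (frobeniusNormSq (uncurry (fun t x => fderiv ℝ (u t) x) z)) =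
          ENNReal.ofReal (frobeniusNormSq (uncurry G' z))
        rw [hz]
    _ < ∞ := hG'int

/-- **Dissipation tails**: for `δ > 0` there is `0 < τ ≤ T` with `∫∫_{(T−τ,T) × ℝ³} |∇u|² < δ`
(continuity from above of the finite measure with density `|∇u|²` on the slab along the cylinders
`(T − T/(n+1), T) × ℝ³ ↓ ∅`). [folklore] -/
theorem exists_time_tail_lt (H : AxisymmetricTypeIHyp ν T u p) {δ : ℝ≥0∞} (hδ : 0 < δ) :
    ∃ τ : ℝ, 0 < τ ∧ τ ≤ T ∧
      ∫⁻ z in Ioo (T - τ) T ×ˢ (univ : Set ℝ³),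
        ENNReal.ofReal (frobeniusNormSq (fderiv ℝ (u z.1) z.2)) < δ := by
  have hT := H.time_pos
  set μF : Measure (ℝ × ℝ³) := (volume : Measure (ℝ × ℝ³)).withDensity
    (fun z => ENNReal.ofReal (frobeniusNormSq (fderiv ℝ (u z.1) z.2))) with hμF
  set s : ℕ → Set (ℝ × ℝ³) := fun n => Ioo (T - T / ((n : ℝ) + 1)) T ×ˢ (univ : Set ℝ³) with hs
  have hsm : ∀ n, MeasurableSet (s n) := fun n => measurableSet_Ioo.prod MeasurableSet.univ
  have hanti : Antitone s := by
    intro m n hmn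
    refine prod_mono (Ioo_subset_Ioo_left ?_) subset_rfl
    have h1 : (m : ℝ) + 1 ≤ n + 1 := by exact_mod_cast Nat.succ_le_succ hmn
    have h2 : T / ((n : ℝ) + 1) ≤ T / ((m : ℝ) + 1) :=
      div_le_div_of_nonneg_left hT.le (by positivity) h1
    linarith
  have hinter : ⋂ n, s n = ∅ := by
    ext z
    simp only [mem_iInter, mem_empty_iff_false, iff_false]
    intro hz
    have hlt : z.1 < T := (hz 0).1.2
    have hpos : 0 < T - z.1 := by linarith
    obtain ⟨n, hn⟩ := exists_nat_ge (T / (T - z.1))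
    have hzn := (hz n).1.1
    have h3 : T / (T - z.1) < n + 1 := by linarith
    have h4 : T < ((n : ℝ) + 1) * (T - z.1) := by rwa [div_lt_iff₀ hpos] at h3
    have h5 : T / ((n : ℝ) + 1) < T - z.1 := by
      rw [div_lt_iff₀ (by positivity)]
      linarith
    linarith
  have hfin : μF (s 0) ≠ ∞ := by
    rw [hμF, withDensity_apply _ (hsm 0)]
    have e : s 0 = Ioo 0 T ×ˢ (univ : Set ℝ³) := by
      simp [hs]
    rw [e]
    exact H.lintegral_slab_frobeniusNormSq_fderiv_lt_top.ne
  have htend := tendsto_measure_iInter_atTop (μ := μF) (fun n => (hsm n).nullMeasurableSet)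
    hanti ⟨0, hfin⟩
  rw [hinter, measure_empty] at htend
  obtain ⟨n, hn⟩ := ((tendsto_order.1 htend).2 δ hδ).exists
  refine ⟨T / ((n : ℝ) + 1), by positivity, div_le_self hT.le (by linarith [n.cast_nonneg (α := ℝ)]), ?_⟩
  have hn' : μF (s n) < δ := hn
  rwa [hμF, withDensity_apply _ (hsm n)] at hn'

/-! ### From the essential bound of the rescaled solution back to `u` -/

/-- **Transport of an essential bound near the vertex.** If the rescaled field
`α u(T + β s, x₀ + R y)` is essentially bounded on a backward cylinder `Q(0, r)`, then `u` is
bounded on a backward neighbourhood of `(T, x₀)` (the bound transported along the measure-scaling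
affine bijection `Φ`, then from a.e. to everywhere by the continuity of `u` below `T`). [folklore] -/
theorem isBoundedNearTop_of_eLpNorm_rescaled_lt_top (H : AxisymmetricTypeIHyp ν T u p) (x₀ : ℝ³)
    {α β R r : ℝ} (hα : 0 < α) (hβ : 0 < β) (hR : 0 < R) (hr : 0 < r)
    (hbd : eLpNorm (uncurry (α • stPull β R T x₀ u)) ∞
      (volume.restrict (parabolicCylinder r (0 : ℝ × ℝ³))) < ∞) :
    IsBoundedNearTop u T x₀ := by
  have hT := H.time_pos
  -- an a.e. bound for `u ∘ Φ` on `Q_r(0)`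
  set S' : Set (ℝ × ℝ³) := parabolicCylinder r (0 : ℝ × ℝ³) with hS'
  set M : ℝ := (eLpNorm (uncurry (α • stPull β R T x₀ u)) ∞ (volume.restrict S')).toReal with hM
  have haeS' : ∀ᵐ w ∂(volume.restrict S'),
      ‖u (stAffine β R T x₀ w).1 (stAffine β R T x₀ w).2‖ ≤ M / α := by
    have h1 := ae_le_eLpNormEssSup (μ := volume.restrict S') (f := uncurry (α • stPull β R T x₀ u))
    filter_upwards [h1] with w hw
    rw [← eLpNorm_exponent_top] at hw
    have hw' : ‖uncurry (α • stPull β R T x₀ u) w‖ ≤ M := by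
      rw [hM, ← ENNReal.ofReal_le_iff_le_toReal hbd.ne, ofReal_norm]
      exact hw
    rw [le_div_iff₀' hα]
    have e : uncurry (α • stPull β R T x₀ u) w =
        α • u (stAffine β R T x₀ w).1 (stAffine β R T x₀ w).2 := by
      obtain ⟨s, y⟩ := w; rfl
    rw [e, norm_smul, Real.norm_of_nonneg hα.le] at hw'
    exact hw'
  -- transported to the image `Φ(Q_r(0))`
  have haeP : ∀ᵐ z ∂((volume : Measure (ℝ × ℝ³)).restrict (stAffine β R T x₀ '' S')),
      ‖u z.1 z.2‖ ≤ M / α := by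
    refine ae_restrict_of_ae_restrict_preimage_stAffine hβ hR T x₀
      (P := fun z : ℝ × ℝ³ => ‖u z.1 z.2‖ ≤ M / α) ?_
    rw [preimage_image_eq _ (injective_stAffine hβ.ne' hR.ne' T x₀)]
    exact haeS'
  -- a backward neighbourhood of `(T, x₀)` inside `Φ(Q_r(0))` and inside the slab
  set r' : ℝ := min (r * min (Real.sqrt β) R) (Real.sqrt T / 2) with hr'
  have hmin : 0 < min (Real.sqrt β) R := lt_min (Real.sqrt_pos.2 hβ) hR
  have hr'pos : 0 < r' := lt_min (mul_pos hr hmin) (by positivity)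
  have hr'le : r' ≤ r * min (Real.sqrt β) R := min_le_left _ _
  have hr'T : r' ^ 2 ≤ T / 4 := by
    have h1 : r' ≤ Real.sqrt T / 2 := min_le_right _ _
    have h2 : r' ^ 2 ≤ (Real.sqrt T / 2) ^ 2 := pow_le_pow_left₀ hr'pos.le h1 2
    rw [div_pow, Real.sq_sqrt hT.le] at h2
    linarith
  set U : Set (ℝ × ℝ³) := Ioo (T - r' ^ 2) T ×ˢ ball x₀ r' with hU
  have hUsub : U ⊆ stAffine β R T x₀ '' S' := by
    rintro ⟨t, x⟩ ⟨ht, hx⟩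
    refine ⟨((t - T) / β, R⁻¹ • (x - x₀)), ?_, ?_⟩
    · rw [hS', mem_parabolicCylinder]
      have hr'β : r' ^ 2 ≤ β * r ^ 2 := by
        have h1 : r' ≤ r * Real.sqrt β :=
          hr'le.trans (mul_le_mul_of_nonneg_left (min_le_left _ _) hr.le)
        have h2 : r' ^ 2 ≤ (r * Real.sqrt β) ^ 2 := pow_le_pow_left₀ hr'pos.le h1 2
        rw [mul_pow, Real.sq_sqrt hβ.le] at h2
        linarith
      have hr'R : r' ≤ R * r := by
        have h1 : r' ≤ r * R := hr'le.trans (mul_le_mul_of_nonneg_left (min_le_right _ _) hr.le)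
        linarith
      refine ⟨⟨?_, ?_⟩, ?_⟩
      · show (0 : ℝ) - r ^ 2 < (t - T) / β
        rw [lt_div_iff₀ hβ]; nlinarith [ht.1]
      · show (t - T) / β < 0
        exact div_neg_of_neg_of_pos (by linarith [ht.2]) hβ
      · show dist (R⁻¹ • (x - x₀)) 0 < r
        rw [dist_zero_right, norm_smul, Real.norm_of_nonneg (inv_nonneg.2 hR.le),
          inv_mul_lt_iff₀ hR]
        rw [mem_ball, dist_eq_norm] at hx
        linarith
    · rw [stAffine_apply]
      ext1
      · show T + β * ((t - T) / β) = t
        field_simp; ring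
      · show x₀ + R • R⁻¹ • (x - x₀) = x
        rw [smul_smul, mul_inv_cancel₀ hR.ne', one_smul, add_sub_cancel]
  -- everywhere bound on `U` by continuity
  have hUopen : IsOpen U := isOpen_Ioo.prod isOpen_ball
  have hUslab : U ⊆ Ioo 0 T ×ˢ (univ : Set ℝ³) := by
    rintro ⟨t, x⟩ ⟨ht, -⟩
    exact ⟨⟨by nlinarith [ht.1], ht.2⟩, mem_univ _⟩
  have hcont : ContinuousOn (fun z : ℝ × ℝ³ => u z.1 z.2) U :=
    H.classical_Ioo.smooth_velocity.continuousOn.mono hUslab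
  have hbound := SereginSverak2009.forall_le_of_ae_le_of_continuousOn hUopen hcont.norm
    continuousOn_const (ae_restrict_of_ae_restrict_of_subset hUsub haeP)
  exact ⟨r', hr'pos, M / α, fun t ht x hx => hbound (t, x) ⟨ht, hx⟩⟩

end AxisymmetricTypeIHyp

/-! ### The off-axis input from Seregin's criterion -/

section OffAxis

variable {ν T : ℝ} {u : ℝ → ℝ³ → ℝ³} {p : ℝ → ℝ³ → ℝ}

/-- **Off-axis points are regular** — PROOF of the named target
`axisymmetric_typeI_boundedNearTop_offAxis` (`AxisymmetricTypeIBounded.lean`) from the accepted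
backward ε-regularity criterion in the multi-scale dissipation form `seregin2014_thm14`
(Seregin 2014, Ch. 6, §6.1, Thm. 1.4), along the argument of the module docstring (rotation
invariance and packing of the dissipation, vanishing dissipation tails, viscosity-normalising
parabolic rescaling about `(T, x₀)`, transport of the essential bound back to `u`).
[cite: Seregin2014, Ch. 6 §6.1 Thm. 1.4] -/
theorem axisymmetric_typeI_boundedNearTop_offAxis_of_seregin (hS : seregin2014_thm14) :
    axisymmetric_typeI_boundedNearTop_offAxis := by
  intro ν T u p H x₀ hx₀
  obtain ⟨ε, hε, hcrit⟩ := hS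
  have hν := H.viscosity_pos
  have hT := H.time_pos
  have hρ₀ : 0 < cylRadius x₀ := lt_of_le_of_ne (cylRadius_nonneg x₀) (Ne.symm hx₀)
  -- vanishing dissipation tails: `D(τ₀) < ε ν ρ₀`
  obtain ⟨τ₀, hτ₀, hτ₀T, hDτ₀⟩ := H.exists_time_tail_lt
    (δ := ENNReal.ofReal (ε * ν * cylRadius x₀)) (ENNReal.ofReal_pos.2 (by positivity))
  -- scales: `R > 0` with `R ≤ ρ₀`, `R²/ν ≤ τ₀`, `ρ = R (2 + 1/√ν) ≤ √T / 2`
  set κ : ℝ := 2 + (Real.sqrt ν)⁻¹ with hκ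
  have hκpos : 0 < κ := by positivity
  set R : ℝ := min (Real.sqrt T / (2 * κ)) (min (cylRadius x₀) (Real.sqrt (ν * τ₀))) with hR
  have hRpos : 0 < R := lt_min (by positivity) (lt_min hρ₀ (Real.sqrt_pos.2 (by positivity)))
  have hRρ₀ : R ≤ cylRadius x₀ := (min_le_right _ _).trans (min_le_left _ _)
  have hRτ : R ^ 2 / ν ≤ τ₀ := by
    have h1 : R ≤ Real.sqrt (ν * τ₀) := (min_le_right _ _).trans (min_le_right _ _)
    have h2 : R ^ 2 ≤ ν * τ₀ := by
      have := pow_le_pow_left₀ hRpos.le h1 2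
      rwa [Real.sq_sqrt (by positivity)] at this
    rw [div_le_iff₀ hν]
    linarith
  set ρ : ℝ := R * κ with hρ
  have hρT : ρ ^ 2 ≤ T := by
    have h1 : ρ ≤ Real.sqrt T / 2 := by
      have : R ≤ Real.sqrt T / (2 * κ) := min_le_left _ _
      rw [hρ]
      calc R * κ ≤ Real.sqrt T / (2 * κ) * κ := mul_le_mul_of_nonneg_right this hκpos.le
        _ = Real.sqrt T / 2 := by field_simp
    have h2 : ρ ^ 2 ≤ (Real.sqrt T / 2) ^ 2 := pow_le_pow_left₀ (by positivity) h1 2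
    rw [div_pow, Real.sq_sqrt hT.le] at h2
    linarith
  set α : ℝ := R / ν with hα
  set β : ℝ := R ^ 2 / ν with hβdef
  have hαpos : 0 < α := by positivity
  have hβpos : 0 < β := by positivity
  have hβeq : β = α * R := by rw [hβdef, hα]; field_simp
  have hβρ : β ≤ ρ ^ 2 := by
    have h1 : β = (R * (Real.sqrt ν)⁻¹) ^ 2 := by
      rw [hβdef, mul_pow, inv_pow, Real.sq_sqrt hν.le, div_eq_mul_inv]
    rw [h1, hρ]
    have h2 : (Real.sqrt ν)⁻¹ ≤ κ := by rw [hκ]; linarith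
    have h3 : 0 ≤ (Real.sqrt ν)⁻¹ := by positivity
    exact pow_le_pow_left₀ (by positivity) (mul_le_mul_of_nonneg_left h2 hRpos.le) 2
  have hRρ : R ≤ ρ := by
    rw [hρ, hκ]
    have : 0 ≤ (Real.sqrt ν)⁻¹ := by positivity
    nlinarith
  have hβT : β ≤ T := hβρ.trans hρT
  have hβτ₀ : β ≤ τ₀ := hRτ
  -- the gauged pressure and the `ν`-cylinders about `(T, x₀)`
  obtain ⟨q, hsuit, hqae, -⟩ := H.exists_gauged_pressure
  have hcylslab : parabolicCylinder ρ ((T : ℝ), x₀) ⊆ Ioo 0 T ×ˢ (univ : Set ℝ³) := by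
    intro z hz
    rw [mem_parabolicCylinder] at hz
    exact ⟨⟨by nlinarith [hz.1.1], hz.1.2⟩, mem_univ _⟩
  -- the `ν`-cylinder `(T - (Rr)²/ν, T) × B(x₀, Rr)`, `0 < r ≤ 1`, lies in `Q_ρ(T, x₀)`
  have hνcyl : ∀ r : ℝ, 0 < r → r ≤ 1 →
      Ioo (T - (R * r) ^ 2 / ν) T ×ˢ ball x₀ (R * r) ⊆ parabolicCylinder ρ ((T : ℝ), x₀) := by
    intro r hr hr1
    have hRr : R * r ≤ R := mul_le_of_le_one_right hRpos.le hr1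
    have h1 : (R * r) ^ 2 / ν ≤ ρ ^ 2 := by
      refine le_trans ?_ hβρ
      rw [hβdef]
      exact div_le_div_of_nonneg_right (pow_le_pow_left₀ (by positivity) hRr 2) hν.le
    rintro ⟨t, x⟩ ⟨ht, hx⟩
    rw [mem_parabolicCylinder]
    refine ⟨⟨by linarith [ht.1], ht.2⟩, ?_⟩
    rw [mem_ball] at hx
    exact lt_of_lt_of_le hx (hRr.trans hRρ)
  set PO : Opens (ℝ × ℝ³) := ⟨Ioo (T - β) T ×ˢ ball x₀ R, isOpen_Ioo.prod isOpen_ball⟩ with hPO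
  have hPOcyl : (PO : Set (ℝ × ℝ³)) ⊆ parabolicCylinder ρ ((T : ℝ), x₀) := by
    have := hνcyl 1 one_pos le_rfl
    rw [mul_one] at this
    exact this
  have hPOslab : (PO : Set (ℝ × ℝ³)) ⊆ Ioo 0 T ×ˢ (univ : Set ℝ³) := hPOcyl.trans hcylslab
  -- `Φ⁻¹(PO) = Q(0, 1)`
  have hpre1 : stPreimage β R T x₀ PO = parabolicCylinderOpens 1 (0 : ℝ × ℝ³) := by
    apply Opens.ext
    rw [coe_stPreimage]
    have h := stAffine_preimage_cylinder_eq_parabolicCylinder hν hRpos T x₀ R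
    rw [div_self hRpos.ne'] at h
    exact h
  -- the rescaled pair is a suitable weak solution of the unit-viscosity system on `Q(0, 1)`
  have hsuit1 : IsSuitableWeakSolutionOn (parabolicCylinderOpens 1 (0 : ℝ × ℝ³)) 1 0
      (α • stPull β R T x₀ u) (α ^ 2 • stPull β R T x₀ q) := by
    have h0 := (hsuit PO hPOslab).stRescale hαpos hRpos hβeq T x₀
    have hvisc : α * ν / R = 1 := by
      rw [hα, div_mul_cancel₀ R hν.ne', div_self hRpos.ne']
    have hforce : ((α ^ 2 * R) • stPull β R T x₀ (0 : ℝ → ℝ³ → ℝ³)) = 0 := by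
      funext s y; simp [stPull]
    rw [hvisc, hforce, hpre1] at h0
    exact h0
  -- the rescaled classical gradient
  have hGu : HasWeakSpatialGradientOn PO u fun t x => fderiv ℝ (u t) x :=
    hasWeakSpatialGradientOn_of_contDiffOn isOpen_Ioo hPOslab
      (H.classical_Ioo.smooth_velocity.of_le (by norm_cast))
  have hGv : HasWeakSpatialGradientOn (parabolicCylinderOpens 1 (0 : ℝ × ℝ³))
      (α • stPull β R T x₀ u) ((α * R) • stPull β R T x₀ fun t x => fderiv ℝ (u t) x) := by
    rw [← hpre1]
    exact hGu.stRescale α hβpos hRpos T x₀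
  -- the dissipation of the rescaled pair on `Q(0, r)` by change of variables
  have hEr : ∀ r : ℝ, 0 < r →
      ∫⁻ z in parabolicCylinder r (0 : ℝ × ℝ³), ENNReal.ofReal (frobeniusNormSq
          (((α * R) • stPull β R T x₀ fun t x => fderiv ℝ (u t) x) z.1 z.2)) =
        ENNReal.ofReal ((α * R) ^ 2) * ENNReal.ofReal (β * R ^ 3)⁻¹ *
          ∫⁻ z in Ioo (T - (R * r) ^ 2 / ν) T ×ˢ ball x₀ (R * r),
            ENNReal.ofReal (frobeniusNormSq (fderiv ℝ (u z.1) z.2)) := by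
    intro r hr
    have hpre : parabolicCylinder r (0 : ℝ × ℝ³) =
        stAffine β R T x₀ ⁻¹' (Ioo (T - (R * r) ^ 2 / ν) T ×ˢ ball x₀ (R * r)) := by
      rw [hβdef, stAffine_preimage_cylinder_eq_parabolicCylinder hν hRpos T x₀ (R * r),
        mul_div_cancel_left₀ r hRpos.ne']
      rfl
    rw [hpre, setLIntegral_frobeniusNormSq_stRescale hβpos hRpos T x₀ (α * R), finrank_euclideanSpace_fin]
  -- `E(r) ≤ D(τ₀) / (ν ρ₀)` for `0 < r < 1`
  have hcknE : ∀ r ∈ Ioo (0 : ℝ) 1,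
      cknE r (0 : ℝ × ℝ³) ((α * R) • stPull β R T x₀ fun t x => fderiv ℝ (u t) x) ≤
        ENNReal.ofReal (ν * cylRadius x₀)⁻¹ *
          ∫⁻ z in Ioo (T - τ₀) T ×ˢ (univ : Set ℝ³),
            ENNReal.ofReal (frobeniusNormSq (fderiv ℝ (u z.1) z.2)) := by
    intro r hr
    have hr0 : 0 < r := hr.1
    have hr0' : r ≠ 0 := hr0.ne'
    have hRr : 0 < R * r := mul_pos hRpos hr0
    have hRrR : R * r ≤ R := mul_le_of_le_one_right hRpos.le hr.2.le
    have hRrρ₀ : R * r ≤ cylRadius x₀ := hRrR.trans hRρ₀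
    have hτ : (R * r) ^ 2 / ν ≤ τ₀ := by
      refine le_trans ?_ hRτ
      exact div_le_div_of_nonneg_right (pow_le_pow_left₀ hRr.le hRrR 2) hν.le
    have hτT : (R * r) ^ 2 / ν ≤ T := hτ.trans hτ₀T
    have hpack := H.setLIntegral_prod_ball_le_of_axisymmetric hρ₀ hRr hRrρ₀ hτT
    have hmono : ∫⁻ z in Ioo (T - (R * r) ^ 2 / ν) T ×ˢ (univ : Set ℝ³),
          ENNReal.ofReal (frobeniusNormSq (fderiv ℝ (u z.1) z.2)) ≤
        ∫⁻ z in Ioo (T - τ₀) T ×ˢ (univ : Set ℝ³),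
          ENNReal.ofReal (frobeniusNormSq (fderiv ℝ (u z.1) z.2)) :=
      lintegral_mono_set (prod_mono (Ioo_subset_Ioo_left (by linarith)) subset_rfl)
    unfold cknE
    rw [hEr r hr0]
    have key : (ENNReal.ofReal r)⁻¹ * (ENNReal.ofReal ((α * R) ^ 2) * ENNReal.ofReal (β * R ^ 3)⁻¹ *
        (ENNReal.ofReal (R * r / cylRadius x₀) *
          ∫⁻ z in Ioo (T - τ₀) T ×ˢ (univ : Set ℝ³),
            ENNReal.ofReal (frobeniusNormSq (fderiv ℝ (u z.1) z.2)))) =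
        ENNReal.ofReal (ν * cylRadius x₀)⁻¹ *
          ∫⁻ z in Ioo (T - τ₀) T ×ˢ (univ : Set ℝ³),
            ENNReal.ofReal (frobeniusNormSq (fderiv ℝ (u z.1) z.2)) := by
      rw [← ENNReal.ofReal_inv_of_pos hr0, ← mul_assoc, ← mul_assoc, ← mul_assoc,
        ← ENNReal.ofReal_mul (inv_nonneg.2 hr0.le),
        ← ENNReal.ofReal_mul (by positivity : (0 : ℝ) ≤ r⁻¹ * (α * R) ^ 2),
        ← ENNReal.ofReal_mul (by positivity : (0 : ℝ) ≤ r⁻¹ * (α * R) ^ 2 * (β * R ^ 3)⁻¹)]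
      congr 2
      rw [hα, hβdef]
      field_simp
    rw [← key]
    gcongr
    exact hpack.trans (mul_le_mul' le_rfl hmono)
  -- the rescaled pair in the class `IsSuitableWeakSolutionInBall 1 0`
  have hball : IsSuitableWeakSolutionInBall 1 0 (α • stPull β R T x₀ u) (α ^ 2 • stPull β R T x₀ q) := by
    refine ⟨hsuit1, ?_, ⟨_, hGv, ?_⟩, ?_⟩
    · -- energy class from the energy inequality
      set CE : ℝ≥0∞ := ENNReal.ofReal (2 * VectorCalculus.kineticEnergy (u 0)) with hCE
      have hphys : ∀ᵐ t ∂(volume.restrict (Ioo (T + β * (-1)) (T + β * 0))),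
          ∫⁻ x in ball x₀ R, ‖u t x‖ₑ ^ 2 ≤ CE := by
        refine (ae_restrict_mem measurableSet_Ioo).mono fun t ht => ?_
        have htI : t ∈ Ico 0 T := ⟨by nlinarith [ht.1], by simpa using ht.2⟩
        exact (setLIntegral_le_lintegral _ _).trans (H.eEnergy_le htI)
      have h2 := ae_sliced_setLIntegral_ball_stRescale hβpos hRpos T x₀ x₀ R (-1) 0
        (fun t x => ‖u t x‖ₑ ^ 2) hphys
      rw [finrank_euclideanSpace_fin, sub_self, smul_zero, div_self hRpos.ne'] at h2
      set C₁ : ℝ≥0∞ := ‖α‖ₑ ^ 2 * (ENNReal.ofReal (R ^ 3)⁻¹ * CE) with hC₁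
      have hC₁top : C₁ ≠ ∞ :=
        ENNReal.mul_ne_top (by simp) (ENNReal.mul_ne_top ENNReal.ofReal_ne_top ENNReal.ofReal_ne_top)
      refine ⟨C₁.toNNReal, ?_⟩
      rw [ENNReal.coe_toNNReal hC₁top]
      have hset : Ioo ((0 : ℝ × ℝ³).1 - 1 ^ 2) (0 : ℝ × ℝ³).1 = Ioo (-1 : ℝ) 0 := by simp
      rw [hset]
      filter_upwards [h2] with s hs
      have e : ∀ y : ℝ³, ‖(α • stPull β R T x₀ u) s y‖ₑ ^ 2 =
          ‖α‖ₑ ^ 2 * ‖u (T + β * s) (x₀ + R • y)‖ₑ ^ 2 := by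
        intro y
        rw [smul_stPull_apply, enorm_smul, mul_pow]
      simp only [e]
      rw [lintegral_const_mul' _ _ (by simp)]
      exact mul_le_mul' le_rfl hs
    · -- `∫_{Q(0,1)} |∇v|² < ∞`
      rw [hEr 1 one_pos]
      refine ENNReal.mul_lt_top (ENNReal.mul_lt_top ENNReal.ofReal_lt_top ENNReal.ofReal_lt_top) ?_
      refine lt_of_le_of_lt (lintegral_mono_set ?_) H.lintegral_slab_frobeniusNormSq_fderiv_lt_top
      rw [mul_one]
      exact prod_mono (Ioo_subset_Ioo_left (by linarith)) (subset_univ _)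
    · -- `π ∈ L^{3/2}(Q(0,1))`
      refine ⟨hsuit1.distributional.2.2.1.aestronglyMeasurable, ?_⟩
      have h32 : ((3 : ℝ≥0∞) / 2).toReal = 3 / 2 := by
        rw [ENNReal.toReal_div]; norm_num
      have h32top : (3 : ℝ≥0∞) / 2 ≠ ∞ := (ENNReal.div_lt_top (by simp) (by simp)).ne
      rw [eLpNorm_eq_lintegral_rpow_enorm_toReal (by norm_num) h32top, h32]
      refine ENNReal.rpow_lt_top_of_nonneg (by positivity) (ne_of_lt ?_)
      have hQ1 : parabolicCylinder 1 (0 : ℝ × ℝ³) = stAffine β R T x₀ ⁻¹' (PO : Set (ℝ × ℝ³)) := by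
        rw [← coe_stPreimage, hpre1]; rfl
      rw [hQ1]
      show ∫⁻ z in stAffine β R T x₀ ⁻¹' (PO : Set (ℝ × ℝ³)),
          ‖(α ^ 2 • stPull β R T x₀ q) z.1 z.2‖ₑ ^ (3 / 2 : ℝ) < ∞
      rw [setLIntegral_enorm_rpow_stRescale hβpos hRpos T x₀ (α ^ 2) q _ (by norm_num)]
      refine ENNReal.mul_lt_top (ENNReal.mul_lt_top
        (ENNReal.rpow_lt_top_of_nonneg (by norm_num) enorm_ne_top) ENNReal.ofReal_lt_top) ?_
      exact lt_of_le_of_lt (lintegral_mono_set hPOcyl)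
        (H.lintegral_cylinder_gauged_pressure_lt_top hqae hρT x₀)
  -- smallness of the multi-scale dissipation
  have hsmall : (⨆ r ∈ Ioo (0 : ℝ) 1,
      cknE r (0 : ℝ × ℝ³) ((α * R) • stPull β R T x₀ fun t x => fderiv ℝ (u t) x)) <
        ENNReal.ofReal ε := by
    refine lt_of_le_of_lt (iSup₂_le fun r hr => hcknE r hr) ?_
    have hc0 : ENNReal.ofReal (ν * cylRadius x₀)⁻¹ ≠ 0 :=
      (ENNReal.ofReal_pos.2 (by positivity)).ne'
    calc ENNReal.ofReal (ν * cylRadius x₀)⁻¹ *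
          ∫⁻ z in Ioo (T - τ₀) T ×ˢ (univ : Set ℝ³),
            ENNReal.ofReal (frobeniusNormSq (fderiv ℝ (u z.1) z.2))
        < ENNReal.ofReal (ν * cylRadius x₀)⁻¹ * ENNReal.ofReal (ε * ν * cylRadius x₀) := by
          have := ENNReal.mul_lt_mul_left hc0 ENNReal.ofReal_ne_top hDτ₀
          simpa only [mul_comm] using this
      _ = ENNReal.ofReal ε := by
          rw [← ENNReal.ofReal_mul (by positivity)]
          congr 1
          field_simp
  -- the criterion, and transport back to `u`
  obtain ⟨ϱ, hϱ, hbd⟩ := hcrit _ _ hball ⟨_, hGv, hsmall⟩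
  exact H.isBoundedNearTop_of_eLpNorm_rescaled_lt_top x₀ hαpos hβpos hRpos hϱ.1 hbd

end OffAxis

end Literature.Analysis.FluidPDE

end
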